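import Mathlib
import HarnessLib
import HarnessLib.Audit
import Summits.CriticalPhenomena.Statement
import Literature.Probability.RandomPlanarGeometry.SLEConvergenceCriterion
import HarnessLib.Audit.Status.Attr

/-!
Route: SAWQuadrupoleWard

DORMANT since 2026-08-25T12:41:48Z (reconciler: no traction for 7.7 d (last activity item-evidence-added at 2026-08-17T19:14:43Z); parked, not closed — `ledger route dormant route-CriticalPhenomena-SAWQuadrupoleWard --off` to reactivate) — unstaffed, not closed; items shared with open routes are served there. `ledger route dormant <id> --off` reactivates.

# Route SAWQuadrupoleWard — the SAW's orientation quadrupole is its stress tensor — interior +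
boundary lattice Ward identities force conformal restriction covariance of subsequential limits,
hence SLE(8/3)

It suffices to show X = InteriorWard ∧ BoundaryWard ∧ SimpleSubseqLimits ∧ EventualTight (idea card
quadrupole-ward-two-bodies,
its corner (Q3) "local Ward = conformal invariance", made crux-first on rigid δℤ²; (Q2) "two bodies"
is built into the lattice
tensor; (Q1) "universality engine" is filed as the stand-alone crux StiffnessUniversality). The
lattice stress tensor of the
critical square-lattice SAW γ is the pair of orientation-quadrupole densities OF THE WALK ITSELF:
the axis body q₊(e) = ±1
(horizontal / vertical edge of γ) and the diagonal body q×(v) = ±1 (corner chirality of γ at v: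
NE–SW vs NW–SE chord, 0 on
straight passages); paired with the two traceless-strain components of a test field v (Re and Im of
2∂̄v = ∂ₓv + i∂_yv) and
weighted by two mesh-dependent normalisations κ₁(δ), κ₂(δ) it gives the lattice functional
Q^κ_δ(2∂̄v)(γ).
InteriorWard (IW): one pair κ₁, κ₂ : ℝ → ℝ makes, for EVERY Dobrushin domain, endpoint
approximation, compactly supported C²
field v (flow φ_t) and bounded continuous test f on curves, E_δ[f∘φ₁] − E_δ[f] − Cov_δ(∫₀¹ f∘φ_t dt,
Q^κ_δ(2∂̄v)) → 0: the
quadrupole covariance GENERATES interior deformations. BoundaryWard (BW): with the same κ, along the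
flow g_t of a field u
holomorphic near D̄, vanishing at a, b and mapping D into itself, the exact lattice restriction to
the shrinking domains
D_t = g_t(D) is generated by the same collar covariance: E_{(D_t)_δ}[f] − E_{D_δ}[f] − ∫₀ᵗ
Cov_{(D_s)_δ}(f, Q^κ_δ(2∂̄(χu))) ds → 0
for f local to a compact K ⊂ D_t and a cutoff χ = 1 near K. SimpleSubseqLimits: subsequential limits
are simple chords
touching ∂D only at a, b. EventualTight: eventual tightness (shared, stmt-CriticalPhenomena-1881).
Then WardIntegration
(IW → BW → SimpleSubseqLimits → conformal-restriction covariance of every subsequential limit under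
inward holomorphic flows) and
FlowRestrictionRigidity (that covariance + simplicity ⇒ chordal SLE_{8/3} law, Lawler–Schramm–Werner
2003) give the shared
identification statement of stmt-CriticalPhenomena-0783, and TightnessCriterion (the SAW instance of
the tree's PROVED
criterion convergesInLawToSLE_of_isTightAlongMesh', shared with route SAWParafermion as
stmt-CriticalPhenomena-10209) closes
the conjunct; the deciding theorem `closes` is pure logic over these seven items.
Lean: `InteriorWard ∧ BoundaryWard ∧ SimpleSubseqLimits ∧ EventualTight`

## Assembly
Deciding theorem (glue.lean, D-0027): closes : InteriorWard → BoundaryWard → WardIntegration →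
SimpleSubseqLimits →
FlowRestrictionRigidity → EventualTight → TightnessCriterion → SAWScalingLimit, by pure logic — for
(D; a_δ, b_δ) with
IsEndpointApprox, TightnessCriterion D a b consumes EventualTight D a b and the identification
`fun μ hμ ⟨s, hs, hlim⟩ ↦ FlowRestrictionRigidity (WardIntegration IW BW SSL) SSL D a b hab s μ hs
hμ hlim`, and returns
ConvergesInLawToSLE (8/3), i.e. SAWScalingLimit unfolded (Sketch.lean rc 0; axioms propext,
Classical.choice, Quot.sound).
The Assembly item records exactly this seven-hypothesis implication as a statement (restated
2026-08-15 from the rev-1 form,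
which lacked TightnessCriterion and never rendered); Target (stmt-CriticalPhenomena-6554, the
literal conjunction X, renderable
only as a 6.7k-char inlined term and carrying no content of its own) was dropped; the only
non-logical assembly content — eventual probability-normalisation of SAW.law
(IsEndpointApprox.reachable ⇒ weight ≠ 0, finiteness of DomainSAW for
bounded Ω and δ > 0 ⇒ weight ≠ ∞) feeding the proved Prokhorov criterion with
IsSLECurve.map_eq_holds and SAW.aemeasurable_curve —
is the support item TightnessCriterion. StiffnessUniversality and FlowCovariantLimits are
deliberately not hypotheses of closes
(the (Q1) engine is not load-bearing; FlowCovariantLimits is WardIntegration's conclusion kept as a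
stand-alone decl that other
conformal-covariance routes can want).

Rationale: WHY THIS LINE. Mechanism (card quadrupole-ward-two-bodies (Q3), transposing Doyon–Riva–Cardy
arXiv:math-ph/0511054 Thm 2.1 / Friedrich–Werner
arXiv:math/0301018 and Chelkak–Glazman–Smirnov arXiv:1604.06339 Conjecture T to rigid ℤ² and
REVERSING their direction): in
the continuum, conformal restriction ⇒ the spin-2, order-ε² part of local hitting statistics is a
holomorphic stress tensor
obeying the c = 0 Ward identities; here the lattice walk supplies T for free as its edge-orientation
/ corner-chirality
imbalance (Kadanoff–Ceva doi:10.1103/physrevb.3.3918 and Cardy 1996 ch. 11 dictionary T_xx−T_yy ↔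
E_h−E_v, T_xy ↔ diagonal
difference, at n → 0 energy = occupation), and conformal covariance is OUTPUT: because restriction
is exact on the lattice
(LawlerSchrammWerner2004SAW §3.4.5), the defect E_f(t) = E_{P_{D_t}}[f] − E_{P_D}[f∘g_t] along a
holomorphic flow satisfies
E_f(t+s) = E^{D_t}_f(s) + E^D_{f∘g_s}(t); IW and BW at the SAME domain D_t cancel the first term to
o(s), and the germ trick
Q(t) := E^D_{f∘g_{−t}}(t) has zero derivative — no hierarchy of multiple-T insertions and no
tensorial transformation law of T
is ever needed (this closure is the route's structural observation). Flows compose and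
Loewner–Kufarev chains exhaust the
conformal self-embeddings of (D; a, b), so every subsequential limit is a chordal restriction
measure on simple curves, i.e.
SLE_{8/3} (LawlerSchrammWerner2003Restriction). Imported areas: conformal field theory (stress
tensor as generator, Ward
identities, Doyon's conformal derivatives arXiv:1004.0138 / arXiv:1209.1560), conformal restriction
(LSW03), Loewner theory
(semigroup generation). What no prior route does: SAWConfRestriction / SAWRestrictionRigidity /
SAWInfinitesimalRigidity leave
conformal covariance as an undecomposed crux or a continuum rigidity bet; SAWParafermion /
SAWResidueField need a discrete
holomorphic observable (none exists on ℤ²: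
Literature.Barriers.CriticalPhenomena.not_hasExactVertexRelationZ2); this line asks
holomorphy only in the limit, of a POSITIVE-measure covariance field with two independent real
lattice components per point,
and states both halves as single-limit lattice identities that a Monte-Carlo run can photograph.

RANKED CRUXES. #2 InteriorWard (crux) — (card W2/(Q3), flow form) there are normalisations κ₁ κ₂ : ℝ
→ ℝ (mesh-dependent, domain-independent) such that for every Dobrushin domain D, endpoint
approximation, C² compactly supported field v in D with global flow φ, and bounded continuous f on
CurveClass ℂ: E_δ[f(φ₁∘γ)] − E_δ[f(γ)] − Cov_δ(∫₀¹ f(φ_t∘γ)dt, Q^κ_δ(2∂̄v)(γ)) → 0 as δ → 0⁺, where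
Q^κ_δ(s)(γ) = κ₁(δ) Σ_edges Re s(mid e)·(Δx²−Δy²)/δ² + κ₂(δ) Σ_corners Im s(v)·(ΔX·ΔY)/δ² over the
mesh polyline of γ (axis quadrupole and corner chirality). [difficulty: open-problem] (why it might
fail: On the walk the quadrupole is a spin-2 TWO-LEG field of dimension exactly 2 = dim T (DRC
x_n=1−κ/8+κn²/8 at n=2, κ=8/3): T's log-partner t. If q = δ²(aT + a′t) with a′ ≠ 0 and no log(1/δ)
enhancement of T, no κ(δ) works; an antisymmetric (torque) response would also kill it.)
[arXiv:math-ph/0511054, arXiv:1604.06339, arXiv:cond-mat/0409105, arXiv:1109.3174,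
doi:10.1103/physrevb.3.3918, arXiv:1004.0138,
Summits/CriticalPhenomena/SAWScalingLimit/Ideas/quadrupole-ward-two-bodies.md]
#3 BoundaryWard (crux) — (card (Q3) boundary half; CGS p.5 'on the boundary Conjecture T for n = 0
agrees with the restriction property') for every κ₁ κ₂ satisfying the InteriorWard identity: for
every Dobrushin domain D, endpoint approximation also joined in the sub-domains, u holomorphic on a
neighbourhood of D̄ (C² on ℂ) with u(a) = u(b) = 0 whose flow g maps D into D up to time t₀ (g_t
Lipschitz), compact K ⊂ g_{t₀}(D), C² cutoff χ = 1 near K supported in g_{t₀}(D), and bounded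
continuous f invariant under homeomorphisms fixing K pointwise: for t ∈ (0, t₀], E_{law((g_t
D)_δ)}[f] − E_{law(D_δ)}[f] − ∫₀ᵗ Cov_{law((g_s D)_δ)}(f, Q^κ_δ(2∂̄(χu))) ds → 0 as δ → 0⁺ (exact
lattice restriction makes the first difference a conditioning; the claim is that the boundary
variation is generated by the interior collar covariance — the boundary values of the holomorphic
response equal the touching response). [deps: InteriorWard] [difficulty: open-problem] (why it might
fail: Needs the collar covariance's boundary limit to equal the restriction (touching) derivative:
boundary two-leg density ~δ² with a UNIVERSAL ratio to the bulk normalisation κ(δ); Kennedy–Lawler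
direction-dependent boundary factors on ℤ² could make the ratio depend on the slope of ∂D.)
[arXiv:1604.06339, arXiv:math/0301018, arXiv:math-ph/0511054, LawlerSchrammWerner2004SAW,
KennedyLawler2013, LawlerSchrammWerner2003Restriction]
#4 WardIntegration (crux) — IW → BW → SimpleSubseqLimits → FlowCovariantLimits (restated 2026-08-15:
SimpleSubseqLimits added as a hypothesis, because the portmanteau step for the closed-range event
A_t = {range ⊆ cl g_t(D)} needs μ(∂A_t) = 0, which only boundary avoidance / simplicity of the limit
provides — route review rreview-063f8436 on stmt-6557; SSL and FCL are inlined in the Lean term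
because they render below this item): the two lattice identities integrate, along every inward
holomorphic flow, to conformal-restriction covariance of every subsequential weak limit μ of the SAW
law in D: μ(A_t) · (g_t)_*μ = μ restricted to A_t. Proof plan: pass IW/BW to the limit along the
subsequence (T-covariances bounded via an a-priori bound extracted along a further subsequence),
differentiate at t = 0⁺ using K-local test functions, and run the germ trick Q(t) =
E^D_{f∘g_{−t}}(t), Q′ ≡ 0, at the domains D_t = g_t(D) (Dobrushin domains via MarkedDomain.map);
K-local functionals with K ↑ D determine μ given SSL. [deps: InteriorWard, BoundaryWard,
SimpleSubseqLimits] [difficulty: L] (why it might fail: The germ trick needs IW/BW UNIFORMLY over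
the flowed family (D_t, f∘g_s) or simultaneous subsequential limits in all D_t, plus an a-priori
bound |Cov_δ(h∘curve, Q^κ_δ(s))| ≤ C(s)‖h‖_BL uniform in δ that IW does not state; even given SSL,
K-local test functions may not determine μ.) [arXiv:1004.0138, arXiv:1209.1560, arXiv:0908.1511,
LawlerSchrammWerner2004SAW, Literature.Probability.RandomPlanarGeometry.MarkedDomain.map]
#5 SimpleSubseqLimits (crux) — for every Dobrushin domain, endpoint approximation, mesh sequence s_n
→ 0⁺ and probability measure μ on CurveClass ℂ that is the weak limit of the SAW laws along s_n,
μ-a.e. curve is simple and meets ∂D only at the marked points a, b (per-subsequence form of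
SAWConfRestriction's SimpleOfLimit; needed to land in LSW's class of restriction measures on simple
curves, exponent 5/8). [difficulty: open-problem] (why it might fail: Weak limits of simple
polylines need not be simple: needs uniform no-macroscopic-self-touching and no-boundary-crawling
bounds at x_c under EVERY IsEndpointApprox (interior endpoints, tangential approach); only
sub-ballisticity is in print; Kennedy–Lawler boundary lattice effects.) [LawlerSchrammWerner2004SAW,
KennedyLawler2013, DuminilCopinHammond2013, arXiv:2310.17299, LawlerSchrammWerner2003Restriction]
#6 StiffnessUniversality (crux) — (card W1/(Q1), the universality ENGINE's first deliverable; not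
load-bearing for the deciding theorem) semi-flexible SAW universality on ℤ²: for every stiffness y >
0, with Z_n(y) = Σ_{n-step SAW from 0} y^{#turns}, μ(y) = inf_n (max(1,y) Z_n(y))^{1/n} (= lim
Z_n^{1/n} by super/sub-multiplicativity) and x_c(y) = 1/μ(y), the chordal law P^{(y)}_δ ∝
x_c(y)^{|γ|} y^{turns(γ)} on SAWs of Ω_δ from a_δ to b_δ and the critical SAW law SAW.law have
asymptotically equal test integrals (difference → 0 as δ → 0⁺) for every Dobrushin domain, endpoint
approximation and bounded continuous f. Mechanism: d/dy E_y[F] = Cov_y(F, S_y) with the D4-symmetric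
re-tuned score S_y = N_turn/y + (log x_c)′(y)|γ|, whose spin-2 component vanishes by symmetry (card
symmetry lemma), so the covariance → 0 and the limit is constant in y. [difficulty: XL] (why it
might fail: The typed form needs no tightness but asserts asymptotic equality for ALL endpoint
approximations: stiffness changes the local law near interior lattice endpoints a_δ, b_δ
(finite-size boundary terms must wash out); a D4-even score can still couple to a marginal
staggered/spin-4 sector.) [arXiv:cond-mat/0409355, doi:10.1088/1742-5468/ad1d5a,
GlazmanManolescu2019, Summits/CriticalPhenomena/SAWScalingLimit/Ideas/quadrupole-ward-two-bodies.md,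
Summits/CriticalPhenomena/SAWScalingLimit/Ideas/honeycomb-inside-z2-weight-homotopy.md]
#9 FlowCovariantLimits (support) — the conclusion of WardIntegration as a stand-alone decl (so that
other conformal-covariance routes can want it): every subsequential weak limit μ of the critical SAW
law in a Dobrushin domain D is conformal-restriction covariant under the time-t map of every inward
holomorphic flow g fixing a, b: μ(A_t) · (g_t)_*μ = μ|_{A_t}, A_t = curves with range ⊆ closure
g_t(D). [difficulty: open-problem] [LawlerSchrammWerner2003Restriction, LawlerSchrammWerner2004SAW,
arXiv:math-ph/0511054]
#9 FlowRestrictionRigidity (support) — FlowCovariantLimits → SimpleSubseqLimits → (verbatim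
stmt-CriticalPhenomena-0783) every subsequential limit is the chordal SLE_{8/3} law: covariance
under flow maps is closed under composition ((g∘h)_*μ = μ(·| ⊆ ghD)) and weak limits,
Loewner–Kufarev chains exhaust the conformal self-embeddings of (D; a, b) onto hull subdomains, so μ
transported to (ℍ; 0, ∞) satisfies P(γ ∩ A = ∅) = law-of-Φ_A-image, i.e. is a chordal restriction
measure carried by simple curves, hence P_{5/8} = SLE_{8/3} (LSW03 Thm 6.1 / Cor 8.6,
RestrictionMeasuresSimpleHolds / RestrictionMeasuresFiveEighthsHolds in tree); chordality of μ
(source a, target b, range ⊆ D̄) follows from the weak-limit hypothesis. [difficulty: L]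
[LawlerSchrammWerner2003Restriction,
Literature.Probability.RandomPlanarGeometry.IsSLECurve.map_eq_holds, arXiv:math/0209343]
#9 EventualTight (support) — (shared verbatim with route SAWLeftRightFKG,
stmt-CriticalPhenomena-1881) eventual tightness of the pushed-forward critical SAW laws along δ → 0⁺
for every Dobrushin domain and endpoint approximation (IsTightAlongMesh) — the repaired form of the
refuted all-δ Tight (stmt-CriticalPhenomena-0772). [difficulty: open-problem]
[AizenmanBurchardDuke1999, KemppainenSmirnov2017,
Summit.CriticalPhenomena.SAWScalingLimit.Theorems.SAWParafermionTight_refuted]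
#9 TightnessCriterion (support) — (shared verbatim with route SAWParafermion's Assembly2,
stmt-CriticalPhenomena-10209; the whole assembly debt of this route) the SAW instance, along the
germ 𝓝[>]0, of the PROVED criterion convergesInLawToSLE_of_isTightAlongMesh'
(SLEUniquenessInLaw.lean): for every Dobrushin domain and endpoint approximation, eventual tightness
of the pushed-forward critical SAW laws (IsTightAlongMesh) and identification of every probability
subsequential limit law (IsSubseqLimitLaw) as the chordal SLE_{8/3} law give ConvergesInLawToSLE
(8/3); the only work beyond the Literature theorem is its instance [∀ δ, IsProbabilityMeasure (P δ)]
— SAW.law is a probability measure only for small δ > 0 (IsEndpointApprox.reachable ⇒ a path ⇒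
weight ≥ x_c^n > 0 by SAW.Zd.connectiveConstant_pos; DomainSAW finite for bounded Ω, δ > 0 via
meshDomain_finite), so transport to Y := id on CurveClass ℂ with the pushed-forward laws patched by
a fixed Dirac mass at the junk meshes (the three predicates only see the germ at 0⁺; integral_map,
SAW.aemeasurable_curve). [difficulty: M]
[Literature.Probability.RandomPlanarGeometry.convergesInLawToSLE_of_isTightAlongMesh,
Literature.Probability.RandomPlanarGeometry.IsSLECurve.map_eq_holds, BillingsleyCPM1999]

TWO-LAYER PLAN. Foreseen glued splits (none filed now): InteriorWard ⇐ WardBound (a-priori bound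
|Cov_δ(f∘curve, Q^κ_δ(s))| ≤ C(s)‖f‖_BL,
uniform in δ) → PointResponse (existence and interior holomorphy of the response field τ_f(z) = lim
κ(δ)δ⁻²Cov(f, q(z)) off the
support of f, with the transport residues) → InteriorWard; BoundaryWard ⇐ BoundaryDensity
(δ⁻¹-normalised boundary-visit
density of the walk exists jointly with f) → CardyCondition (T_nt = 0 and T_nn = touching density on
∂D) → BoundaryWard;
WardIntegration ⇐ LimitDifferentiability → GermTrick → WardIntegration; StiffnessUniversality ⇐
ScoreDecorrelation
(sup_y |Cov_{y,δ}(f∘curve, S_y)| → 0) → PatternLLN (Kesten pattern densities along the walk,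
SAWPatternTheorem in tree) →
StiffnessUniversality.

KILL CRITERIA. ¬InteriorWard by an explicit functional/field pair for which no mesh-normalisation
fits (e.g. the Monte-Carlo photograph of
z ↦ Cov(1{z₀ left of γ}, q(z)) is NOT ∂S(z₀)/(z−z₀) + endpoint double poles up to two constants, or
needs a z-dependent
mixture) closes the route `refuted:InteriorWard` and retires the (Q3) corner of the card;
¬BoundaryWard with IW standing pivots to
a boundary body (δ⁻¹ boundary-visit density as a third lattice tensor component with its own κ₃) —
restate once, then close.
¬SimpleSubseqLimits or ¬EventualTight under some IsEndpointApprox refutes the conjunct as typed (all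
routes). ¬StiffnessUniversality
kills the (Q1) engine and card honeycomb-inside-z2-weight-homotopy's calculus but not the deciding
theorem. ConfCovLimit
(SAWConfRestriction r2) or SubseqIdentification (stmt-0783) proved elsewhere moots
WardIntegration/FlowRestrictionRigidity.

NOT DECOMPOSED YET. The a-priori covariance bound and pointwise response field (children of
InteriorWard); the boundary-visit density and the
Kennedy–Lawler slope dependence (children of BoundaryWard); differentiability of limits and the
law-determining class of K-local
functionals (children of WardIntegration); Loewner–Kufarev generation and hull approximation inside
FlowRestrictionRigidity
(HullApproximation / RestrictionMeasures* files in tree); the (Q1) engine for the other D4-symmetric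
families (osculation
weight, symmetric next-nearest steps, Glazman–Manolescu θ = π/2 weights =
SAWHexUniversality.YBtoUniform) — siblings of
StiffnessUniversality, filed only if it closes; the (Q2) calibration of κ₂/κ₁ by the
diagonal-stretch family (a Numbers question,
not an item).

CHEAPEST FALSIFIER. Kit experiment W6(iii) of the card at δ = 1/64…1/256 in a 2:1 rectangle with a,
b at the short sides: pivot-MCMC estimate of the
two maps z ↦ Cov(1{z₀ left of γ}, q₊(z)) and z ↦ Cov(1{z₀ left of γ}, q×(z)); InteriorWard predicts
BOTH are δ²κ(δ)⁻¹ × (Re, Im) of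
ONE meromorphic quadratic differential ∂_{z₀}S(z₀)/(z−z₀) + (5/8-type double poles at a, b) +
regular, with exactly two fitted
constants for the whole picture and κ₂/κ₁ independent of z₀ and of the domain. A z-dependent ratio,
a non-harmonic residual at
fixed δ that does not shrink like a power of δ, or growth of the fitted κ(δ)⁻¹ faster than log(1/δ)
kills IW before any prover
touches it. Not run here (planner seat, kit not in payload); DRC Thm 2.1 (read, p.4–9, 14) confirms
the continuum target shape.

NUMBERS. c = 0, h_bdry = 5/8, x₂ (two-leg) = 2/3, d_f = 4/3; DRC spin-n pinch exponents x_n = 1 −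
κ/8 + κn²/8 give x₂ = 2 at κ = 8/3 —
the resonance with dim T = 2 behind the log-partner caveat (Gurarie–Ludwig b-parameter, VJS
arXiv:1109.3174); leading
D4-even correction-to-scaling exponent Δ₁ = 3/2 for 2D SAW (CGJPRS arXiv:cond-mat/0409355) sets the
predicted rate δ^{(4/3)·(3/2)} = δ²
of the (Q1) decorrelation; μ(ℤ²) ≈ 2.63815853; items at open: 10 (5 cruxes, 3 support, target,
assembly); after the 2026-08-15 glue repair: 10 (5 cruxes, 4 support, assembly — Target dropped,
TightnessCriterion added, WardIntegration and Assembly restated; the deciding theorem closes takes 7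
of them).

DEFINITION REQUESTS. None blocking: the quadrupole functional, strain, flows and K-locality are
inlined (lets / hypotheses) so every item elaborates
now (Sketch.lean rc 0). Nice-to-have (would shrink the signatures; to be filed by tenure if the
route gets staffed):
SAW.quadrupolePairing κ₁ κ₂ δ s γ (Literature/Probability/RandomPlanarGeometry),
CurveClass.IsLocalTo K f, and a bundled
holomorphic-flow structure on Dobrushin domains (DobrushinDomain.flow u t with MarkedDomain.map).

Novelty: Searches (2026-08-15): `lit read arXiv:math-ph/0511054` (DRC; pp. 4–9, 14 read: Assumptions 2.1, Thm
2.1, x_n formula, '(π/8)ε²T');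
`lit read arXiv:1604.06339` (CGS; p. 5 Conjecture T, boundary remark for n = 0); `lit search
--source crossref` ×5 ('discrete
stress-energy tensor loop O(n)', 'Doyon calculus on manifolds of conformal maps', 'semi-flexible
self-avoiding walks', 'Kadanoff
Ceva operator algebra': found doi:10.1007/s11005-012-0594-1, doi:10.1088/1751-8113/45/31/315202,
doi:10.1007/jhep11(2022)009,
doi:10.1088/1742-5468/ad1d5a, doi:10.1103/physrevb.3.3918); `lit search --source zbmath` ×2 (Doyon:
arXiv:1209.1560, 0908.1511,
1004.0138; semiflexible: 0); `lit frontier CriticalPhenomena --since 2020` (30 rows, none on lattice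
stress tensors for SAW);
`lit galaxy search --star all` ×4 ('discrete stress-energy tensor' → 1 hit arXiv:2001.11871
dimers/t-embeddings; 'conformal Ward
identities' → 8 hits, all high-energy CFT; two longer phrases 0); local `lit search` daemon and
OpenAlex/arXiv APIs unavailable this
session (ConnectionReset / HTTP 429 — logged in NOTES.md); the card's own audit (Cardy 1996 §11.3,
KadanoffCeva1971, HKV
arXiv:1307.4104, CGS) re-used.
Nearest prior art found: Doyon–Riva–Cardy arXiv:math-ph/0511054 Thm 2.1 and Doyon arXiv:1209.1560 /
arXiv:1004.0138 (continuum,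
FORWARD direction: conformal restriction / CLE axioms ⇒ a stress tensor from spin-2 local shape
probabilities satisfying the c = 0
Ward identities; 'conformal derivative' formalism); Chelkak–  [refs: 10.1007/s11005-012-0594-1, 10.1088/1751-8113/45/31/315202, 10.1007/jhep11(2022, 10.1088/1742-5468/ad1d5a, 10.1103/physrevb.3.3918, math-ph/0511054, 1604.06339, 1209.1560, 2001.11871, 1307.4104, 1004.0138, doi:10.1007/s11005-012-0594-1, doi:10.1088/1751-8113/45/31/315202, doi:10.1007/jhep11, doi:10.1088/1742-5468/ad1d5a, doi:10.1103/physrevb.3.3918, KadanoffCeva1971]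

Barriers (technique_class: stress-tensor ward-identity conformal-restriction): - technique_class: stress-tensor ward-identity conformal-restriction
- Literature.Barriers.CriticalPhenomena.NienhuisWeightsExcludeVertexSAW: evaded by construction — no
exact local linear relation for any ℤ² observable is posited (not_hasExactVertexRelationZ2 stands);
holomorphy is asked only in the δ → 0 limit, of a covariance field with TWO independent real lattice
components per point (q₊, q×), so nothing has to be reconstructed from half of Cauchy–Riemann.
- Literature.Barriers.CriticalPhenomena.ParafermionicHalfCauchyRiemann: not engaged — no
parafermion, no winding phase, no vertex relation; the observable is real and positive-measure
(orientation counts of the walk).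
- Literature.Barriers.CriticalPhenomena.EmbeddingModulusUniqueness: respected, not evaded for free —
the embedding-sensitive input is exactly IW (a symmetric traceless two-body tensor with
domain-independent κ₂/κ₁ presumes the isotropic modulus; an antisymmetric torque response is named
as a failure mode), so rotation covariance is paid for by a falsifiable lattice identity rather than
assumed.
- Literature.Barriers.CriticalPhenomena.ScaleCovarianceNotMoebius: its moral (D4 + scaling ⇏
conformal) is precisely what BW adds: the boundary/restriction response generated by the interior
tensor is the extra, non-symmetry input; the route does not claim an upgrade from lattice
symmetries.
- Literature.Barriers.CriticalPhenomena.SAWNoUnitaryCFT: consistent and USED — no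
positivity/unitarity of T is invoked; c = 0

Novelty grade: new-combination — ROUTE REVIEW (refuter rreview-063f8436, 2026-08-15) VERDICT keep open but STRUCTURALLY BLOCKED until one planner edit: shared item stmt-1881 `EventualTight` (announced in the thesis) is NOT attached (route has 9 items; 1881.wanted_by lacks this route) while Target 6554 / Assembly 6561 name it ⇒ the  (refuter refuter-rreview-route-CriticalPhenomena--063f8436-0, 2026-08-15T14:02:56Z; prior: arXiv:math-ph/0511054,arXiv:1209.1560,arXiv:1004.0138,arXiv:1604.06339,doi:10.1103/physrevb.3.3918,arXiv:cond-mat/0409105,arXiv:1109.3174,arXiv:math/0209343)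

History (route lifecycle, newest last):
- 2026-08-15T16:19:50Z · rev 2: restated WardIntegration (stmt-CriticalPhenomena-6557) — route-repair (glue), step 1/2: the rev-1 file rendered Target/WardIntegration/Assembly as BLOCKED TODOs (stale missing-decl flags from route-open, before Eventu (planner-rbadge-CriticalPhenomena-SAWQuadrupole-d87149bd-g4-0)
- 2026-08-15T16:19:50Z · rev 2: dropped Target — route-repair (glue), step 1/2: the rev-1 file rendered Target/WardIntegration/Assembly as BLOCKED TODOs (stale missing-decl flags from route-open, before Eventu (planner-rbadge-CriticalPhenomena-SAWQuadrupole-d87149bd-g4-0)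
- 2026-08-15T16:20:56Z · rev 3: restated Assembly (stmt-CriticalPhenomena-6561) — route-repair (glue), step 2/2: restate Assembly := InteriorWard → BoundaryWard → WardIntegration → SimpleSubseqLimits → FlowRestrictionRigidity → EventualTight (planner-rbadge-CriticalPhenomena-SAWQuadrupole-d87149bd-g4-0)
- 2026-08-25T12:41:48Z · DORMANT — reconciler: no traction for 7.7 d (last activity item-evidence-added at 2026-08-17T19:14:43Z); parked, not closed — `ledger route dormant route-CriticalPhenomen (operator:999:4138431)

sub-problem: SAWScalingLimit · status: dormant · opened planner-plancard-CriticalPhenomena-SAWScaling-d1a9ac43-0 2026-08-15T11:48:14Z · rev 3 · ledger route-CriticalPhenomena-SAWQuadrupoleWard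
GENERATED by the gate from the ledger (D-0016/17). Provers cite these decls: `theorem foo : Summit.CriticalPhenomena.SAWScalingLimit.Theses.SAWQuadrupoleWard.<Decl> := …` in Summits/CriticalPhenomena/SAWScalingLimit/Theorems/<Name>.lean.
-/

namespace Summit.CriticalPhenomena.SAWScalingLimit.Theses.SAWQuadrupoleWard

open scoped BigOperators Topology Manifold Classical MeasureTheory ProbabilityTheory Matrix InnerProductSpace ComplexConjugate ContinuousMap
open Filter Set Function TopologicalSpace MeasureTheory

attribute [summit_statement] _root_.SAWScalingLimit

/-- item stmt-CriticalPhenomena-6555 · crux · rank 2 · open · by planner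
why it might fail: On the walk the quadrupole is a spin-2 TWO-LEG field of dimension exactly 2 = dim T (DRC x_n=1−κ/8+κn²/8 at n=2, κ=8/3): T's log-partner t. If q = δ²(aT + a′t) with a′ ≠ 0 and no log(1/δ) enhancement of T, no κ(δ) works; an antisymmetric (torque) response would also kill it.
sources: arXiv:math-ph/0511054, arXiv:1604.06339, arXiv:cond-mat/0409105, arXiv:1109.3174, doi:10.1103/physrevb.3.3918, arXiv:1004.0138
[crux] (card W2/(Q3), flow form) there are normalisations κ₁ κ₂ : ℝ → ℝ (mesh-dependent,
domain-independent) such that for every Dobrushin domain D, endpoint approximation, C² compactly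
supported field v in D with global flow φ, and bounded continuous f on CurveClass ℂ: E_δ[f(φ₁∘γ)] −
E_δ[f(γ)] − Cov_δ(∫₀¹ f(φ_t∘γ)dt, Q^κ_δ(2∂̄v)(γ)) → 0 as δ → 0⁺, where Q^κ_δ(s)(γ) = κ₁(δ) Σ_edges
Re s(mid e)·(Δx²−Δy²)/δ² + κ₂(δ) Σ_corners Im s(v)·(ΔX·ΔY)/δ² over the mesh polyline of γ (axis
quadrupole and corner chirality). [difficulty: open-problem] -/
@[route_item "route-CriticalPhenomena-SAWQuadrupoleWard", crux]
def InteriorWard : Prop :=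
  ∃ κ₁ κ₂ : ℝ → ℝ, ∀ (D : Literature.Probability.RandomPlanarGeometry.DobrushinDomain) (a b : ℝ → Literature.Probability.LatticeModels.Site 2), Literature.Probability.RandomPlanarGeometry.SAW.IsEndpointApprox D a b → let P := fun (Ω : Set ℂ) (δ : ℝ) => Literature.Probability.RandomPlanarGeometry.SAW.law Ω δ (a δ) (b δ); ∀ (v : ℂ → ℂ), ContDiff ℝ 2 v → tsupport v ⊆ D.carrier → ∀ (φ : ℝ → ℂ → ℂ) (hφ : ∀ t, Continuous (φ t)), (∀ z, φ 0 z = z) → (∀ t z, HasDerivAt (fun r => φ r z) (v (φ t z)) t) → ∀ f : BoundedContinuousFunction (Literature.Probability.RandomPlanarGeometry.CurveClass ℂ) ℝ, let strain : (ℂ → ℂ) → ℂ → ℂ := fun w z => fderiv ℝ w z 1 + Complex.I * fderiv ℝ w z Complex.I; let quad : ℝ → (ℂ → ℂ) → List (Literature.Probability.LatticeModels.Site 2) → ℝ := fun δ s xs => let l := xs.map (Literature.Probability.LatticeModels.meshPoint δ); κ₁ δ * (List.zipWith (fun p q : ℂ => (s ((p + q) / 2)).re * (((q - p).re) ^ 2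 - ((q - p).im) ^ 2) / δ ^ 2) l l.tail).sum + κ₂ δ * (List.zipWith3 (fun p q r : ℂ => (s q).im * ((r - p).re * (r - p).im) / δ ^ 2) l l.tail l.tail.tail).sum; let fbar : Literature.Probability.RandomPlanarGeometry.CurveClass ℂ → ℝ := fun c => ∫ t in (0 : ℝ)..1, f (Literature.Probability.RandomPlanarGeometry.CurveClass.map ⟨φ t, hφ t⟩ c); Filter.Tendsto (fun δ : ℝ => (∫ γ, f (Literature.Probability.RandomPlanarGeometry.CurveClass.map ⟨φ 1, hφ 1⟩ γ.curve) ∂(P D.carrier δ)) - (∫ γ, f γ.curve ∂(P D.carrier δ)) - ((∫ γ, fbar γ.curve * quad δ (strain v) γ.walk.support ∂(P D.carrier δ)) - (∫ γ, fbar γ.curve ∂(P D.carrier δ)) * (∫ γ, quad δ (strain v) γ.walk.support ∂(P D.carrier δ)))) (nhdsWithin 0 (Set.Ioi 0)) (nhds 0)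

/-- item stmt-CriticalPhenomena-6556 · crux · rank 3 · open · by planner
why it might fail: Needs the collar covariance's boundary limit to equal the restriction (touching) derivative: boundary two-leg density ~δ² with a UNIVERSAL ratio to the bulk normalisation κ(δ); Kennedy–Lawler direction-dependent boundary factors on ℤ² could make the ratio depend on the slope of ∂D.
sources: arXiv:1604.06339, arXiv:math/0301018, arXiv:math-ph/0511054, LawlerSchrammWerner2004SAW, KennedyLawler2013, LawlerSchrammWerner2003Restriction
[crux] (card (Q3) boundary half; CGS p.5 'on the boundary Conjecture T for n = 0 agrees with the
restriction property') for every κ₁ κ₂ satisfying the InteriorWard identity: for every Dobrushin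
domain D, endpoint approximation also joined in the sub-domains, u holomorphic on a neighbourhood of
D̄ (C² on ℂ) with u(a) = u(b) = 0 whose flow g maps D into D up to time t₀ (g_t Lipschitz), compact
K ⊂ g_{t₀}(D), C² cutoff χ = 1 near K supported in g_{t₀}(D), and bounded continuous f invariant
under homeomorphisms fixing K pointwise: for t ∈ (0, t₀], E_{law((g_t D)_δ)}[f] − E_{law(D_δ)}[f] −
∫₀ᵗ Cov_{law((g_s D)_δ)}(f, Q^κ_δ(2∂̄(χu))) ds → 0 as δ → 0⁺ (exact lattice restriction makes the
first difference a conditioning; the claim is that the boundary variation is generated by the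
interior collar covariance — the boundary values of the holomorphic response equal the touching
response). [deps: InteriorWard] [difficulty: open-problem] -/
@[route_item "route-CriticalPhenomena-SAWQuadrupoleWard", crux]
def BoundaryWard : Prop :=
  ∀ κ₁ κ₂ : ℝ → ℝ, (∀ (D : Literature.Probability.RandomPlanarGeometry.DobrushinDomain) (a b : ℝ → Literature.Probability.LatticeModels.Site 2), Literature.Probability.RandomPlanarGeometry.SAW.IsEndpointApprox D a b → let P := fun (Ω : Set ℂ) (δ : ℝ) => Literature.Probability.RandomPlanarGeometry.SAW.law Ω δ (a δ) (b δ); ∀ (v : ℂ → ℂ), ContDiff ℝ 2 v → tsupport v ⊆ D.carrier → ∀ (φ : ℝ → ℂ → ℂ) (hφ : ∀ t, Continuous (φ t)), (∀ z, φ 0 z = z) → (∀ t z, HasDerivAt (fun r => φ r z) (v (φ t z)) t) → ∀ f : BoundedContinuousFunction (Literature.Probability.RandomPlanarGeometry.CurveClass ℂ) ℝ, let strain : (ℂ → ℂ) → ℂ → ℂ := fun w z => fderiv ℝ w z 1 + Complex.I * fderiv ℝ w z Complex.I; let quad : ℝ → (ℂ → ℂ) → List (Literature.Probability.LatticeModels.Site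 2) → ℝ := fun δ s xs => let l := xs.map (Literature.Probability.LatticeModels.meshPoint δ); κ₁ δ * (List.zipWith (fun p q : ℂ => (s ((p + q) / 2)).re * (((q - p).re) ^ 2 - ((q - p).im) ^ 2) / δ ^ 2) l l.tail).sum + κ₂ δ * (List.zipWith3 (fun p q r : ℂ => (s q).im * ((r - p).re * (r - p).im) / δ ^ 2) l l.tail l.tail.tail).sum; let fbar : Literature.Probability.RandomPlanarGeometry.CurveClass ℂ → ℝ := fun c => ∫ t in (0 : ℝ)..1, f (Literature.Probability.RandomPlanarGeometry.CurveClass.map ⟨φ t, hφ t⟩ c); Filter.Tendsto (fun δ : ℝ => (∫ γ, f (Literature.Probability.RandomPlanarGeometry.CurveClass.map ⟨φ 1, hφ 1⟩ γ.curve) ∂(P D.carrier δ)) - (∫ γ, f γ.curve ∂(P D.carrier δ)) - ((∫ γ, fbar γ.curve * quad δ (strain v) γ.walk.support ∂(P D.carrier δ)) - (∫ γ, fbar γ.curve ∂(P D.carrier δ)) * (∫ γ, quad δ (strain v) γ.walk.support ∂(P D.carrier δ)))) (nhdsWithin 0 (Set.Ioi 0)) (nhds 0)) → ∀ (D : Literature.Probability.RandomPlanarGeometry.DobrushinDomain)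 (a b : ℝ → Literature.Probability.LatticeModels.Site 2), Literature.Probability.RandomPlanarGeometry.SAW.IsEndpointApprox D a b → let P := fun (Ω : Set ℂ) (δ : ℝ) => Literature.Probability.RandomPlanarGeometry.SAW.law Ω δ (a δ) (b δ); ∀ (u : ℂ → ℂ) (U : Set ℂ), IsOpen U → closure D.carrier ⊆ U → DifferentiableOn ℂ u U → ContDiff ℝ 2 u → u (D.pt 0) = 0 → u (D.pt 1) = 0 → ∀ (g : ℝ → ℂ → ℂ) (hg : ∀ t, Continuous (g t)) (t₀ : ℝ), 0 < t₀ → (∀ z, g 0 z = z) → (∀ t, ∃ K, LipschitzWith K (g t)) → (∀ t ∈ Set.Icc (0 : ℝ) t₀, ∀ z ∈ closure D.carrier, HasDerivAt (fun r => g r z) (u (g t z)) t) → (∀ t ∈ Set.Icc (0 : ℝ) t₀, g t '' D.carrier ⊆ D.carrier) → (∀ t ∈ Set.Icc (0 : ℝ) t₀, ∀ᶠ δ in nhdsWithin 0 (Set.Ioi 0), (Literature.Probability.LatticeModels.discreteDomainGraph (g t '' D.carrier) δ).Reachable (a δ) (b δ)) → ∀ (K : Set ℂ), IsCompact K → K ⊆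 g t₀ '' D.carrier → ∀ (χ : ℂ → ℝ), ContDiff ℝ 2 χ → (∀ᶠ z in nhdsSet K, χ z = 1) → tsupport χ ⊆ g t₀ '' D.carrier → ∀ f : BoundedContinuousFunction (Literature.Probability.RandomPlanarGeometry.CurveClass ℂ) ℝ, (∀ ψ : ℂ ≃ₜ ℂ, (∀ z ∈ K, ψ z = z) → ∀ c, f (Literature.Probability.RandomPlanarGeometry.CurveClass.map (ψ : C(ℂ, ℂ)) c) = f c) → ∀ t ∈ Set.Ioc (0 : ℝ) t₀, let strain : (ℂ → ℂ) → ℂ → ℂ := fun w z => fderiv ℝ w z 1 + Complex.I * fderiv ℝ w z Complex.I; let quad : ℝ → (ℂ → ℂ) → List (Literature.Probability.LatticeModels.Site 2) → ℝ := fun δ s xs => let l := xs.map (Literature.Probability.LatticeModels.meshPoint δ); κ₁ δ * (List.zipWith (fun p q : ℂ => (s ((p + q) / 2)).re * (((q - p).re) ^ 2 - ((q - p).im) ^ 2) / δ ^ 2) l l.tail).sum + κ₂ δ * (List.zipWith3 (fun p q r : ℂ => (s q).im * ((r - p).re * (r - p).im) / δ ^ 2) l l.tail l.tail.tail).sum;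 let v : ℂ → ℂ := fun z => (χ z : ℂ) * u z; Filter.Tendsto (fun δ : ℝ => (∫ γ, f γ.curve ∂(P (g t '' D.carrier) δ)) - (∫ γ, f γ.curve ∂(P D.carrier δ)) - ∫ s in (0 : ℝ)..t, ((∫ γ, f γ.curve * quad δ (strain v) γ.walk.support ∂(P (g s '' D.carrier) δ)) - (∫ γ, f γ.curve ∂(P (g s '' D.carrier) δ)) * (∫ γ, quad δ (strain v) γ.walk.support ∂(P (g s '' D.carrier) δ)))) (nhdsWithin 0 (Set.Ioi 0)) (nhds 0)

-- earlier WardIntegration (stmt-CriticalPhenomena-6557, replaced 2026-08-15T16:19:50Z -> stmt-CriticalPhenomena-10634): retired by None — InteriorWard → BoundaryWard → (∀ (D : Literature.Probability.RandomPlanarGeometry.DobrushinDomain) (a b : ℝ → Literature.Probability.LatticeModels.Site 2), Literature.Probability.RandomPlanarGeometry.SAW.IsEndpointApprox D a b → ∀ (s : ℕ → ℝ) (μ : MeasureTheory.Me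
/-- item stmt-CriticalPhenomena-10634 · crux · rank 4 · open · by planner
why it might fail: The germ trick needs IW/BW UNIFORMLY over the flowed family (D_t, f∘g_s) or simultaneous subsequential limits in all D_t, plus an a-priori bound |Cov_δ(h∘curve, Q^κ_δ(s))| ≤ C(s)‖h‖_BL uniform in δ that IW does not state; even given SSL, K-local test functions may not determine μ.
sources: arXiv:1004.0138, arXiv:1209.1560, arXiv:0908.1511, LawlerSchrammWerner2004SAW, Literature.Probability.RandomPlanarGeometry.MarkedDomain.map
[crux] IW → BW → SimpleSubseqLimits → FlowCovariantLimits (restated 2026-08-15: SimpleSubseqLimits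
added as a hypothesis — the portmanteau step for the closed-range event A_t = {range ⊆ cl g_t(D)}
needs μ(∂A_t) = 0, which only boundary avoidance / simplicity of the subsequential limit provides
(route review rreview-063f8436 on stmt-CriticalPhenomena-6557); SSL and FCL are inlined in the term
because they render below this rank-4 item): the two lattice identities integrate, along every
inward holomorphic flow g fixing a, b, to conformal-restriction covariance of every subsequential
weak limit μ of the critical SAW law in D: μ(A_t) · (g_t)_*μ = μ restricted to A_t. Proof plan: pass
IW/BW to the limit along the subsequence (T-covariances bounded via an a-priori bound extracted
along a further subsequence), differentiate at t = 0⁺ using K-local test functions, and run the germ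
trick Q(t) = E^D_{f∘g_{−t}}(t), Q′ ≡ 0, at the domains D_t = g_t(D) (Dobrushin domains via
MarkedDomain.map); K-local functionals with K ↑ D determine μ given SimpleSubseqLimits. [deps:
InteriorWard, BoundaryWard, SimpleSubseqLimits] [difficulty: L] -/
@[route_item "route-CriticalPhenomena-SAWQuadrupoleWard", crux]
def WardIntegration : Prop :=
  InteriorWard → BoundaryWard → (∀ (D : Literature.Probability.RandomPlanarGeometry.DobrushinDomain) (a b : ℝ → Literature.Probability.LatticeModels.Site 2), Literature.Probability.RandomPlanarGeometry.SAW.IsEndpointApprox D a b → ∀ (s : ℕ → ℝ) (μ : MeasureTheory.Measure (Literature.Probability.RandomPlanarGeometry.CurveClass ℂ)), Filter.Tendsto s Filter.atTop (nhdsWithin 0 (Set.Ioi 0)) → MeasureTheory.IsProbabilityMeasure μ → (∀ f : BoundedContinuousFunction (Literature.Probability.RandomPlanarGeometry.CurveClass ℂ) ℝ, Filter.Tendsto (fun n => ∫ γ, f γ.curve ∂(Literature.Probability.RandomPlanarGeometry.SAW.law D.carrier (s n) (a (s n)) (b (s n)))) Filter.atTop (nhds (∫ x, f x ∂μ))) →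 ∀ᵐ γ ∂μ, γ ∈ Literature.Probability.RandomPlanarGeometry.CurveClass.simple ∧ γ.range ∩ frontier D.carrier ⊆ {D.pt 0, D.pt 1}) → (∀ (D : Literature.Probability.RandomPlanarGeometry.DobrushinDomain) (a b : ℝ → Literature.Probability.LatticeModels.Site 2), Literature.Probability.RandomPlanarGeometry.SAW.IsEndpointApprox D a b → ∀ (s : ℕ → ℝ) (μ : MeasureTheory.Measure (Literature.Probability.RandomPlanarGeometry.CurveClass ℂ)), Filter.Tendsto s Filter.atTop (nhdsWithin 0 (Set.Ioi 0)) → MeasureTheory.IsProbabilityMeasure μ → (∀ f : BoundedContinuousFunction (Literature.Probability.RandomPlanarGeometry.CurveClass ℂ) ℝ, Filter.Tendsto (fun n => ∫ γ, f γ.curve ∂(Literature.Probability.RandomPlanarGeometry.SAW.law D.carrier (s n) (a (s n)) (b (s n)))) Filter.atTop (nhds (∫ x, f x ∂μ))) → ∀ (u : ℂ → ℂ) (U : Set ℂ), IsOpen U → closure D.carrier ⊆ U → DifferentiableOn ℂ u U → ContDiff ℝ 2 u → u (D.pt 0) = 0 → u (D.pt 1) = 0 → ∀ (g : ℝ → ℂ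 → ℂ) (hg : ∀ t, Continuous (g t)) (t₀ : ℝ), 0 < t₀ → (∀ z, g 0 z = z) → (∀ t, ∃ K, LipschitzWith K (g t)) → (∀ t ∈ Set.Icc (0 : ℝ) t₀, ∀ z ∈ closure D.carrier, HasDerivAt (fun r => g r z) (u (g t z)) t) → (∀ t ∈ Set.Icc (0 : ℝ) t₀, g t '' D.carrier ⊆ D.carrier) → ∀ t ∈ Set.Ioc (0 : ℝ) t₀, μ (Literature.Probability.RandomPlanarGeometry.CurveClass.rangeSubset (closure (g t '' D.carrier))) • μ.map (Literature.Probability.RandomPlanarGeometry.CurveClass.map ⟨g t, hg t⟩) = μ.restrict (Literature.Probability.RandomPlanarGeometry.CurveClass.rangeSubset (closure (g t '' D.carrier))))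

/-- item stmt-CriticalPhenomena-4514 · crux · rank 5 · open · by planner
why it might fail: Weak limits of simple polylines need not be simple: needs uniform no-macroscopic-self-touching and no-boundary-crawling bounds at x_c under EVERY IsEndpointApprox (interior endpoints, tangential approach); only sub-ballisticity is in print; Kennedy–Lawler boundary lattice effects.
sources: LawlerSchrammWerner2004SAW, KennedyLawler2013, DuminilCopinHammond2013, arXiv:2310.17299, LawlerSchrammWerner2003Restriction
[crux] (card r4, regularity half; subsequential form of SAWConfRestriction.SimpleOfLimit
stmt-CriticalPhenomena-0774, which asks it only for a FULL limit) for every Dobrushin domain,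
endpoint approximation, mesh sequence s_n → 0+ and probability measure μ on CurveClass ℂ that is the
weak limit of the SAW laws along s_n: μ-a.e. curve is simple and meets ∂Ω only at a, b. This is what
makes subsequential limits Loewner-parametrisable for DrivingIdentification; it is implied by the
conjunct (SLE_{8/3} is a simple chord) and is the target of idea card
brownian-domination-simple-limits. [difficulty: open-problem] -/
@[route_item "route-CriticalPhenomena-SAWQuadrupoleWard", crux]
def SimpleSubseqLimits : Prop :=
  ∀ (D : Literature.Probability.RandomPlanarGeometry.DobrushinDomain) (a b : ℝ → Literature.Probability.LatticeModels.Site 2), Literature.Probability.RandomPlanarGeometry.SAW.IsEndpointApprox D a b → ∀ (s : ℕ → ℝ) (μ : MeasureTheory.Measure (Literature.Probability.RandomPlanarGeometry.CurveClass ℂ)), Filter.Tendsto s Filter.atTop (nhdsWithin 0 (Set.Ioi 0)) → MeasureTheory.IsProbabilityMeasure μ → (∀ f : BoundedContinuousFunction (Literature.Probability.RandomPlanarGeometry.CurveClass ℂ) ℝ, Filter.Tendsto (fun n => ∫ γ, f γ.curve ∂(Literature.Probability.RandomPlanarGeometry.SAW.law D.carrier (s n) (a (s n)) (b (s n)))) Filter.atTop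 (nhds (∫ x, f x ∂μ))) → ∀ᵐ γ ∂μ, γ ∈ Literature.Probability.RandomPlanarGeometry.CurveClass.simple ∧ γ.range ∩ frontier D.carrier ⊆ {D.pt 0, D.pt 1}

/-- item stmt-CriticalPhenomena-6558 · crux · rank 6 · open · by planner
why it might fail: The typed form needs no tightness but asserts asymptotic equality for ALL endpoint approximations: stiffness changes the local law near interior lattice endpoints a_δ, b_δ (finite-size boundary terms must wash out); a D4-even score can still couple to a marginal staggered/spin-4 sector.
sources: arXiv:cond-mat/0409355, doi:10.1088/1742-5468/ad1d5a, GlazmanManolescu2019, Summits/CriticalPhenomena/SAWScalingLimit/Ideas/quadrupole-ward-two-bodies.md, Summits/CriticalPhenomena/SAWScalingLimit/Ideas/honeycomb-inside-z2-weight-homotopy.md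
[crux] (card W1/(Q1), the universality ENGINE's first deliverable; not load-bearing for the
Assembly) semi-flexible SAW universality on ℤ²: for every stiffness y > 0, with Z_n(y) = Σ_{n-step
SAW from 0} y^{#turns}, μ(y) = inf_n (max(1,y) Z_n(y))^{1/n} (= lim Z_n^{1/n} by
super/sub-multiplicativity) and x_c(y) = 1/μ(y), the chordal law P^{(y)}_δ ∝ x_c(y)^{|γ|}
y^{turns(γ)} on SAWs of Ω_δ from a_δ to b_δ and the critical SAW law SAW.law have asymptotically
equal test integrals (difference → 0 as δ → 0⁺) for every Dobrushin domain, endpoint approximation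
and bounded continuous f. Mechanism: d/dy E_y[F] = Cov_y(F, S_y) with the D4-symmetric re-tuned
score S_y = N_turn/y + (log x_c)′(y)|γ|, whose spin-2 component vanishes by symmetry (card symmetry
lemma), so the covariance → 0 and the limit is constant in y. [difficulty: XL] -/
@[route_item "route-CriticalPhenomena-SAWQuadrupoleWard"]
def StiffnessUniversality : Prop :=
  ∀ (y : ℝ), 0 < y → ∀ (D : Literature.Probability.RandomPlanarGeometry.DobrushinDomain) (a b : ℝ → Literature.Probability.LatticeModels.Site 2), Literature.Probability.RandomPlanarGeometry.SAW.IsEndpointApprox D a b → ∀ f : BoundedContinuousFunction (Literature.Probability.RandomPlanarGeometry.CurveClass ℂ) ℝ, let turns : List ℂ → ℕ := fun l => (List.zipWith3 (fun p q r : ℂ => if r - q = q - p then 0 else 1) l l.tail l.tail.tail).sum; let Z : ℕ → ℝ := fun n => ∑ w ∈ Literature.Probability.LatticeModels.box 2 n, ∑ p ∈ ((Literature.Probability.LatticeModels.zdGraph 2).finsetWalkLength n (0 : Literature.Probability.LatticeModels.Site 2) w).filter (fun p => p.IsPath), y ^ turns (p.support.map (Literature.Probability.LatticeModels.meshPoint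 1)); let xc : ℝ := (⨅ n : ℕ, (max 1 y * Z (n + 1)) ^ (1 / ((n : ℝ) + 1)))⁻¹; let W : (δ : ℝ) → MeasureTheory.Measure (Literature.Probability.RandomPlanarGeometry.SAW.DomainSAW D.carrier δ (a δ) (b δ)) := fun δ => MeasureTheory.Measure.sum fun γ => ENNReal.ofReal (xc ^ γ.length * y ^ turns (γ.walk.support.map (Literature.Probability.LatticeModels.meshPoint δ))) • MeasureTheory.Measure.dirac γ; Filter.Tendsto (fun δ : ℝ => (∫ γ, f γ.curve ∂((W δ Set.univ)⁻¹ • W δ)) - ∫ γ, f γ.curve ∂(Literature.Probability.RandomPlanarGeometry.SAW.law D.carrier δ (a δ) (b δ))) (nhdsWithin 0 (Set.Ioi 0)) (nhds 0)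

/-- item stmt-CriticalPhenomena-10209 · support · rank 9 · closed · proved by Summit.CriticalPhenomena.SAWScalingLimit.Theorems.parafermion_assembly2_proof (prover) · by planner
sources: Literature.Probability.RandomPlanarGeometry.convergesInLawToSLE_of_isTightAlongMesh, Literature.Probability.RandomPlanarGeometry.IsSLECurve.map_eq_holds, BillingsleyCPM1999, LawlerSchrammWerner2004SAW
[assembly] rank 1 — REPAIRED assembly (replaces stmt-CriticalPhenomena-0784, vacuous once its
antecedent Tight = stmt-0772 was refuted): the SAW instance, along the germ 𝓝[>]0, of the
Prokhorov/Billingsley criterion — for every Dobrushin domain D and endpoint approximation (a_δ,b_δ)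
(SAW.IsEndpointApprox D a b): IF the curve laws are eventually tight (IsTightAlongMesh (fun δ γ ↦
γ.curve) (fun δ ↦ SAW.law D.carrier δ a_δ b_δ)) AND every subsequential weak limit law μ that is a
probability measure (IsSubseqLimitLaw … μ) is the chordal SLE_{8/3} law in D (IsSLELaw (8/3) D μ),
THEN ConvergesInLawToSLE (8/3) D (fun δ γ ↦ γ.curve) (fun δ ↦ SAW.law …). Proof plan (provable now,
~150 lines): copy Literature convergesInLawToSLE_of_isTightAlongMesh /
IsTightAlongMesh.exists_subseq (SLEConvergenceCriterion.lean) replacing the instance [∀ δ,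
IsProbabilityMeasure (P δ)] by `∀ᶠ δ in 𝓝[>]0, IsProbabilityMeasure (SAW.law D.carrier δ (a δ) (b
δ))` (shift the mesh sequence by N exactly as the proof already does for a.e.-measurability); that
eventual fact follows from IsEndpointApprox.reachable (a walk ⇒ a path ⇒ weight ≥ x_c^n > 0 by
le_connectiveConstant_26) and finiteness of DomainSAW for δ > 0 in -/
@[route_item "route-CriticalPhenomena-SAWQuadrupoleWard", crux]
def TightnessCriterion : Prop :=
  ∀ (D : Literature.Probability.RandomPlanarGeometry.DobrushinDomain) (a b : ℝ → Literature.Probability.LatticeModels.Site 2), Literature.Probability.RandomPlanarGeometry.SAW.IsEndpointApprox D a b → Literature.Probability.RandomPlanarGeometry.IsTightAlongMesh (fun δ (γ : Literature.Probability.RandomPlanarGeometry.SAW.DomainSAW D.carrier δ (a δ) (b δ)) => γ.curve) (fun δ => Literature.Probability.RandomPlanarGeometry.SAW.law D.carrier δ (a δ) (b δ)) → (∀ μ : MeasureTheory.Measure (Literature.Probability.RandomPlanarGeometry.CurveClass ℂ), MeasureTheory.IsProbabilityMeasure μ → Literature.Probability.RandomPlanarGeometry.IsSubseqLimitLaw (fun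 δ (γ : Literature.Probability.RandomPlanarGeometry.SAW.DomainSAW D.carrier δ (a δ) (b δ)) => γ.curve) (fun δ => Literature.Probability.RandomPlanarGeometry.SAW.law D.carrier δ (a δ) (b δ)) μ → Literature.Probability.RandomPlanarGeometry.IsSLELaw ((8 : NNReal) / 3) D μ) → Literature.Probability.RandomPlanarGeometry.ConvergesInLawToSLE ((8 : NNReal) / 3) D (fun δ (γ : Literature.Probability.RandomPlanarGeometry.SAW.DomainSAW D.carrier δ (a δ) (b δ)) => γ.curve) (fun δ => Literature.Probability.RandomPlanarGeometry.SAW.law D.carrier δ (a δ) (b δ))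

/-- item stmt-CriticalPhenomena-1881 · support · rank 9 · open · by planner
why it might fail: Open for SAW: no RSW / annulus-crossing bound at x_c (KemppainenSmirnov2017 §4 covers FKG models only); the all-δ form stmt-CriticalPhenomena-0772 is refuted; only sub-ballisticity is unconditional.
sources: KemppainenSmirnov2017, AizenmanBurchardDuke1999, DuminilCopinHammond2013, LawlerSchrammWerner2004SAW, Summit.CriticalPhenomena.SAWScalingLimit.Theorems.SAWParafermionTight_refuted
[support] EVENTUAL TIGHTNESS of the critical SAW laws: for every Dobrushin domain and endpoint
approximation, IsTightAlongMesh (fun δ γ => γ.curve) (fun δ => SAW.law D δ a_δ b_δ) — for every ε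
some compact set of CurveClass ℂ carries all but ε of the mass for all small δ. This is the form the
Prokhorov criterion convergesInLawToSLE_of_isTightAlongMesh consumes and the repair of the refuted
all-δ Tight (IsTightLaws over δ ∈ (0,1]) suggested by the refuting theorem; offered to routes
SAWParafermion / SAWConfRestriction as their restated r3/r4. -/
@[route_item "route-CriticalPhenomena-SAWQuadrupoleWard", crux]
def EventualTight : Prop :=
  ∀ (D : Literature.Probability.RandomPlanarGeometry.DobrushinDomain) (a b : ℝ → Literature.Probability.LatticeModels.Site 2), Literature.Probability.RandomPlanarGeometry.SAW.IsEndpointApprox D a b → Literature.Probability.RandomPlanarGeometry.IsTightAlongMesh (fun δ (γ : Literature.Probability.RandomPlanarGeometry.SAW.DomainSAW D.carrier δ (a δ) (b δ)) => γ.curve) (fun δ => Literature.Probability.RandomPlanarGeometry.SAW.law D.carrier δ (a δ) (b δ))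

/-- item stmt-CriticalPhenomena-6559 · support · rank 9 · open · by planner
sources: LawlerSchrammWerner2003Restriction, LawlerSchrammWerner2004SAW, arXiv:math-ph/0511054
[support] the conclusion of WardIntegration as a stand-alone decl (so that other
conformal-covariance routes can want it): every subsequential weak limit μ of the critical SAW law
in a Dobrushin domain D is conformal-restriction covariant under the time-t map of every inward
holomorphic flow g fixing a, b: μ(A_t) · (g_t)_*μ = μ|_{A_t}, A_t = curves with range ⊆ closure
g_t(D). [difficulty: open-problem] -/
@[route_item "route-CriticalPhenomena-SAWQuadrupoleWard"]
def FlowCovariantLimits : Prop :=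
  ∀ (D : Literature.Probability.RandomPlanarGeometry.DobrushinDomain) (a b : ℝ → Literature.Probability.LatticeModels.Site 2), Literature.Probability.RandomPlanarGeometry.SAW.IsEndpointApprox D a b → ∀ (s : ℕ → ℝ) (μ : MeasureTheory.Measure (Literature.Probability.RandomPlanarGeometry.CurveClass ℂ)), Filter.Tendsto s Filter.atTop (nhdsWithin 0 (Set.Ioi 0)) → MeasureTheory.IsProbabilityMeasure μ → (∀ f : BoundedContinuousFunction (Literature.Probability.RandomPlanarGeometry.CurveClass ℂ) ℝ, Filter.Tendsto (fun n => ∫ γ, f γ.curve ∂(Literature.Probability.RandomPlanarGeometry.SAW.law D.carrier (s n) (a (s n)) (b (s n)))) Filter.atTop (nhds (∫ x, f x ∂μ))) → ∀ (u : ℂ → ℂ) (U : Set ℂ), IsOpen U → closure D.carrier ⊆ U → DifferentiableOn ℂ u U → ContDiff ℝ 2 u → u (D.pt 0) = 0 → u (D.pt 1) = 0 → ∀ (g : ℝ → ℂ → ℂ) (hg : ∀ t, Continuous (g t)) (t₀ : ℝ), 0 < t₀ → (∀ z, g 0 z = z) → (∀ t, ∃ K, LipschitzWith K (g t)) → (∀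 t ∈ Set.Icc (0 : ℝ) t₀, ∀ z ∈ closure D.carrier, HasDerivAt (fun r => g r z) (u (g t z)) t) → (∀ t ∈ Set.Icc (0 : ℝ) t₀, g t '' D.carrier ⊆ D.carrier) → ∀ t ∈ Set.Ioc (0 : ℝ) t₀, μ (Literature.Probability.RandomPlanarGeometry.CurveClass.rangeSubset (closure (g t '' D.carrier))) • μ.map (Literature.Probability.RandomPlanarGeometry.CurveClass.map ⟨g t, hg t⟩) = μ.restrict (Literature.Probability.RandomPlanarGeometry.CurveClass.rangeSubset (closure (g t '' D.carrier)))

/-- item stmt-CriticalPhenomena-6560 · support · rank 9 · open · by planner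
sources: LawlerSchrammWerner2003Restriction, Literature.Probability.RandomPlanarGeometry.IsSLECurve.map_eq_holds, arXiv:math/0209343
[support] FlowCovariantLimits → SimpleSubseqLimits → (verbatim stmt-CriticalPhenomena-0783) every
subsequential limit is the chordal SLE_{8/3} law: covariance under flow maps is closed under
composition ((g∘h)_*μ = μ(·| ⊆ ghD)) and weak limits, Loewner–Kufarev chains exhaust the conformal
self-embeddings of (D; a, b) onto hull subdomains, so μ transported to (ℍ; 0, ∞) satisfies P(γ ∩ A =
∅) = law-of-Φ_A-image, i.e. is a chordal restriction measure carried by simple curves, hence P_{5/8}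
= SLE_{8/3} (LSW03 Thm 6.1 / Cor 8.6, RestrictionMeasuresSimpleHolds /
RestrictionMeasuresFiveEighthsHolds in tree); chordality of μ (source a, target b, range ⊆ D̄)
follows from the weak-limit hypothesis. [difficulty: L] -/
@[route_item "route-CriticalPhenomena-SAWQuadrupoleWard", crux]
def FlowRestrictionRigidity : Prop :=
  FlowCovariantLimits → SimpleSubseqLimits → ∀ (D : Literature.Probability.RandomPlanarGeometry.DobrushinDomain) (a b : ℝ → Literature.Probability.LatticeModels.Site 2), Literature.Probability.RandomPlanarGeometry.SAW.IsEndpointApprox D a b → ∀ (s : ℕ → ℝ) (μ : MeasureTheory.Measure (Literature.Probability.RandomPlanarGeometry.CurveClass ℂ)), Filter.Tendsto s Filter.atTop (nhdsWithin 0 (Set.Ioi 0)) → MeasureTheory.IsProbabilityMeasure μ → (∀ f : BoundedContinuousFunction (Literature.Probability.RandomPlanarGeometry.CurveClass ℂ) ℝ, Filter.Tendsto (fun n => ∫ γ, f γ.curve ∂(Literature.Probability.RandomPlanarGeometry.SAW.law D.carrier (s n) (a (s n)) (b (s n)))) Filter.atTop (nhds (∫ x, f x ∂μ))) → Literature.Probability.RandomPlanarGeometry.IsSLELaw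 ((8 : NNReal) / 3) D μ

-- earlier Assembly (stmt-CriticalPhenomena-6561, replaced 2026-08-15T16:20:56Z -> stmt-CriticalPhenomena-10670): retired by None — InteriorWard → BoundaryWard → WardIntegration → SimpleSubseqLimits → FlowRestrictionRigidity → EventualTight → SAWScalingLimit
/-- item stmt-CriticalPhenomena-10670 · assembly · rank 1 · open · by planner
sources: Literature.Probability.RandomPlanarGeometry.convergesInLawToSLE_of_isTightAlongMesh, Literature.Probability.RandomPlanarGeometry.IsSLECurve.map_eq_holds, LawlerSchrammWerner2003Restriction
[assembly] InteriorWard → BoundaryWard → WardIntegration → SimpleSubseqLimits →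
FlowRestrictionRigidity → EventualTight → TightnessCriterion → SAWScalingLimit — pure logic,
literally the type of the route's deciding theorem `closes` rendered in this file (for (D; a_δ,
b_δ): TightnessCriterion consumes EventualTight and the identification FlowRestrictionRigidity
(WardIntegration IW BW SSL) SSL read through IsSubseqLimitLaw); kept as the conventional assembly
record. Restated 2026-08-15 from the rev-1 form (which lacked TightnessCriterion, bundled the
SAW.law normalisation into the assembly, and never rendered because of a stale missing-decl flag). -/
@[route_item "route-CriticalPhenomena-SAWQuadrupoleWard"]
def Assembly : Prop :=
  InteriorWard → BoundaryWard → WardIntegration → SimpleSubseqLimits → FlowRestrictionRigidity → EventualTight → TightnessCriterion → SAWScalingLimit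

/-! D-0027 §2.1 — DECIDING THEOREM (planner-authored via `route open/edit --closes-file`; by planner-rbadge-CriticalPhenomena-SAWQuadrupole-d87149bd-g4-0 2026-08-15T16:19:50Z):
its hypotheses are this route's items and its conclusion the sub-problem Statement (glue_lint), and it elaborates with this file. -/

@[closes "route-CriticalPhenomena-SAWQuadrupoleWard"] theorem closes : InteriorWard → BoundaryWard → WardIntegration → SimpleSubseqLimits → FlowRestrictionRigidity → EventualTight → TightnessCriterion → _root_.SAWScalingLimit := by intro hIW hBW hWI hSSL hFRR hET hTC D a b hab; exact hTC D a b hab (hET D a b hab) fun μ hμ hsub => hsub.elim fun s hs => hFRR (hWI hIW hBW hSSL) hSSL D a b hab s μ hs.1 hμ hs.2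

end Summit.CriticalPhenomena.SAWScalingLimit.Theses.SAWQuadrupoleWard
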